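import Summits.ResolutionOfSingularities.ResolutionOfSingularities.Theorems.FrobeniusLadderFInjectiveMacaulayficationToricConePoint
import Summits.ResolutionOfSingularities.ResolutionOfSingularities.Theorems.FrobeniusLadderFInjectiveMacaulayficationRMonoidTStep
import Summits.ResolutionOfSingularities.ResolutionOfSingularities.Theorems.FrobeniusLadderFInjectiveMacaulayficationGermOfGlobalBlowup
import HarnessLib

/-!
# (T-I3b, legality I) THE TORUS FIXED POINT OF THE RECURRENT-MONOID BED `U_R` IS A SINGULAR POINT — embedding dimension 7 > 4, in the kernel
# (crux `FInjectiveMacaulayfication` stmt-ResolutionOfSingularities-15315, chain w45a, door v41.1; res-L1-w45a-plan-1 RULING R23.7 (B-M); seat res-L1-w45a-lead-1 g12)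

[OURS · L1 W4.5a] Support file (`--supports stmt-ResolutionOfSingularities-15315 --as helper`); replaces the role of NO printed item; NOT a statement of any manuscript;
def-free; UNCONDITIONAL; no named fact. AI-written (AI review is weaker than expert review).

First instalment of the LEGALITY of T″-instance #6 (✓ `RMonoidTStep.tStepInstanceAt_recurrentMonoid_rDatum`): the cone point `x` of `U_R = Spec k[R]`
(`k[R] = ToricChart.Ring k PEmpty rDatum ≅ k[x₁,x₃,x₄,x₂x₃x₄,x₂x₄²,x₁x₂x₄,x₁x₂x₃]`) is NOT a regular point, for every field `k`: the seven symbols are indecomposable in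
the monoid (the weight `e₀ − e₁ + e₂ + e₃` counts non-dummy letters), pairwise distinct and generate the maximal ideal `𝔪` (✓ `RMonoidTStep.isMaximal_conePoint`), and `7 > 4`,
so ✓ `ToricConePoint.not_isRegularLocalRing_conePoint` applies (Zariski tangent space of dimension `≥ 7` against `dim ≤ trdeg = 4`). Hence `x ∉ Reg U_R` — the outer
hypothesis «`y ∉ Scheme.regularLocus Y`» of the T″ quantifier block holds at the bed point of instance #6. The remaining legality items (the three singular CURVES through `x`,
i.e. `Supp J̃ ⊆ (Reg)ᶜ` on the germ, and regularity off `V(J)`) are the next instalments. Nothing of the crux is proved; T″ and the F-half stay OPEN.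

* `indecomposable_symbols` — the seven symbol exponents are indecomposable among word exponents of `rDatum`;
* `conePoint_not_isRegularLocalRing` — `k[R]_𝔪` is not regular (binder form, `D = rDatum` literal);
* ★ `conePoint_not_mem_regularLocus` — the cone point of `Spec (ToricChart.Ring k PEmpty rDatum)` is not in the regular locus (named bed).
[folklore; cite: Matsumura1987, §14; CoxLittleSchenck2011, §1.3 (context: the Hilbert basis spans the cotangent space of the torus fixed point)]
-/

-- single-problem summit: the doubled namespace component is forced
set_option linter.dupNamespace false

noncomputable section

namespace Summit.ResolutionOfSingularities.ResolutionOfSingularities.Theorems.FInjectiveMacaulayfication.RMonoidConePoint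

open MvPolynomial AlgebraicGeometry
open Literature.AlgebraicGeometry.Resolution
open Summit.ResolutionOfSingularities.ResolutionOfSingularities.Theorems.WildQuotientResolution.ToricChart
open Summit.ResolutionOfSingularities.ResolutionOfSingularities.Theorems.FInjectiveMacaulayfication

variable (k : Type) [Field k]

/-- **The seven symbols of `k[R]` are indecomposable**: if two word exponents add up to the exponent of a symbol, one of them is `0` (the integral weight
`e₀ − e₁ + e₂ + e₃` of a word exponent is its number of non-dummy letters, and equals `1` on every symbol). [OURS · computation] -/
theorem indecomposable_symbols (D : ConeDatum 4 4) (hD : D = ⟨![1, 0, 1, 1], ![![0, 1, 1, 1], ![0, 1, 0, 2], ![1, 1, 0, 1], ![1, 1, 1, 0]]⟩) :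
    ∀ (i : Fin 7) (w w' : Word 4 4), wordExp D w + wordExp D w' = wordExp D (![pureWord 0, pureWord 2, pureWord 3, mixedWord 0, mixedWord 1, mixedWord 2, mixedWord 3] i) →
      wordExp D w = 0 ∨ wordExp D w' = 0 := by
  intro i w w' hww
  have e0 := congrFun hww 0
  have e1 := congrFun hww 1
  have e2 := congrFun hww 2
  have e3 := congrFun hww 3
  subst hD
  simp only [Pi.add_apply, wordExp, fsum] at e0 e1 e2 e3
  rcases Nat.eq_zero_or_pos (w.wp 0 + w.wp 2 + w.wp 3 + w.wm 0 + w.wm 1 + w.wm 2 + w.wm 3) with h | h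
  · left
    exact RMonoidTStep.wordExp_eq_zero _ rfl w (by omega) (by omega) (by omega) (by omega) (by omega) (by omega) (by omega)
  · right
    fin_cases i <;> simp [pureWord, mixedWord] at e0 e1 e2 e3 <;>
      exact RMonoidTStep.wordExp_eq_zero _ rfl w' (by omega) (by omega) (by omega) (by omega) (by omega) (by omega) (by omega)

/-- **`k[R]_𝔪` IS NOT A REGULAR LOCAL RING** (`𝔪` = the cone point; binder form with the `rDatum` literal, `P` any name of the ideal `𝔪`): seven pairwise distinct
indecomposable generators in dimension `≤ 4`. [OURS · application of `ToricConePoint.not_isRegularLocalRing_conePoint`] -/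
theorem conePoint_not_isRegularLocalRing (D : ConeDatum 4 4) (hD : D = ⟨![1, 0, 1, 1], ![![0, 1, 1, 1], ![0, 1, 0, 2], ![1, 1, 0, 1], ![1, 1, 1, 0]]⟩)
    (P : Ideal (Ring k PEmpty D)) [P.IsPrime] (hP : P = spanWords k PEmpty D ![pureWord 0, pureWord 2, pureWord 3, mixedWord 0, mixedWord 1, mixedWord 2, mixedWord 3]) :
    ¬ IsRegularLocalRing (Localization.AtPrime P) := by
  subst hP
  refine ToricConePoint.not_isRegularLocalRing_conePoint k D ![pureWord 0, pureWord 2, pureWord 3, mixedWord 0, mixedWord 1, mixedWord 2, mixedWord 3] (by norm_num) ?_ ?_ (indecomposable_symbols D hD) (RMonoidTStep.isMaximal_conePoint k D hD)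
  · subst hD; decide
  · subst hD; decide

/-- ★ **THE TORUS FIXED POINT OF `U_R` IS A SINGULAR POINT**: for every field `k`, the cone point `x` (`x.asIdeal = 𝔪`) of `Spec (ToricChart.Ring k PEmpty rDatum)` is not in
the regular locus. [OURS] -/
theorem conePoint_not_mem_regularLocus (x : Spec (.of (Ring k PEmpty RMonoidDefs.rDatum)))
    (hx : x.asIdeal = spanWords k PEmpty RMonoidDefs.rDatum ![pureWord 0, pureWord 2, pureWord 3, mixedWord 0, mixedWord 1, mixedWord 2, mixedWord 3]) :
    x ∉ Scheme.regularLocus (Spec (.of (Ring k PEmpty RMonoidDefs.rDatum))) := by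
  exact GermOfGlobalBlowup.not_mem_regularLocus_Spec_of_not_isRegularLocalRing x
    (conePoint_not_isRegularLocalRing k RMonoidDefs.rDatum rfl x.asIdeal hx)

end Summit.ResolutionOfSingularities.ResolutionOfSingularities.Theorems.FInjectiveMacaulayfication.RMonoidConePoint

end
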